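import Summits.Ventures.HodgeRepro2.T5SU11ResolventNeumann
import Summits.Ventures.HodgeRepro2.T5SU11ResolventWeightedBound

/-!
# The Neumann series of the resolvent converges: the resolvent is analytic in the spectral parameter

For `λ, λ₂ > 1` and a rate `ε` with `max(2 − λ, 2 − λ₂) < ε < min(λ, λ₂)`, let `c₂ = c(λ₂, ε)` be the bound of the
improper Green's operator `G^I_{λ₂}` on the weighted space `|g(s)| ≤ N e^{−εs}` (row 506). For a source `g` of
that space:

* the iterates `h_n = (G^I_{λ₂})^n g` are continuous on `(0, ∞)` with `|h_n(s)| ≤ c₂^n N e^{−εs}`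
  (`iterate_weighted`);
* the terms `(μ − μ₂)^k h_{k+1}(t)` of the Neumann expansion (row 503) are dominated by the geometric series
  `c₂ N e^{−εt} (|μ − μ₂| c₂)^k` (`summable_neumann_terms`), and its remainder
  `(μ − μ₂)^{n+1} G^I_λ h_{n+1}(t)` is `O((|μ − μ₂| c₂)^{n+1})` (`tendsto_neumann_remainder`);

hence, whenever **`|μ − μ₂| c₂ < 1`**,

**`G^I_λ g(t) = Σ_{k=0}^{∞} (μ − μ₂)^k (G^I_{λ₂})^{k+1} g(t)`** for every `t > 0` (`hasSum_neumann_series`,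
`greenSolI_eq_tsum_neumann`)

— the Neumann series of the resolvent `(L − μ)⁻¹` around `(L − μ₂)⁻¹` converges on the disc of radius
`1/‖G^I_{λ₂}‖_ε` in the spectral parameter: the resolvent of the radial Laplacian of the explicit model is an
analytic function of `μ` on the exponentially decaying class. Nothing is claimed about (N).

Blind lane: Mathlib + the HodgeRepro2 prefix only; no sorry; axioms ⊆ {propext, Classical.choice,
Quot.sound}.
-/

namespace Summit.Ventures.HodgeRepro2.T5SU11ResolventNeumannSeries

open Filter Topology MeasureTheory
open Set (Ioi Ioc)
open T5SU11Cartan T5SU11SphericalFunction T5SU11SphericalDecay T5SU11RadialGreenImproper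
  T5SU11RadialGreenImproperStable T5SU11ResolventIdentityDecay T5SU11ResolventNeumann
  T5SU11ResolventWeightedBasis T5SU11ResolventWeightedBound

section measure

variable [MeasurableSpace Circle] [BorelSpace Circle]

variable {lam lam₂ ε : ℝ} (hlam : 1 < lam) (hlam₂ : 1 < lam₂) (hε₁ : 2 - lam < ε) (hε₂ : 2 - lam₂ < ε)
  (hε₃ : ε < lam) (hε₄ : ε < lam₂)
  {g : ℝ → ℝ} (hg : ContinuousOn g (Ioi 0)) {N : ℝ} (hN0 : 0 ≤ N)
  (hN : ∀ s, 0 < s → |g s| ≤ N * Real.exp (-ε * s))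
  {c₂ : ℝ} (hc₂ : 0 ≤ c₂)
  (hbound : ∀ (h : ℝ → ℝ) (N' : ℝ), ContinuousOn h (Ioi 0) → 0 ≤ N' →
    (∀ s, 0 < s → |h s| ≤ N' * Real.exp (-ε * s)) →
    ∀ t, 0 < t → |greenSolI (fun t => sph lam₂ (hyp t)) (sphDecay lam₂) h t| ≤ c₂ * N' * Real.exp (-ε * t))

include hlam₂ hε₂ hg hN0 hN hc₂ hbound in
/-- **The iterates stay in the weighted space with geometric growth of the constant**:
`(G^I_{λ₂})^n g` is continuous on `(0, ∞)` and `|(G^I_{λ₂})^n g(s)| ≤ c₂^n N e^{−εs}`. -/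
theorem iterate_weighted (n : ℕ) :
    ContinuousOn ((greenSolI (fun t => sph lam₂ (hyp t)) (sphDecay lam₂))^[n] g) (Ioi 0) ∧
    ∀ s, 0 < s → |(greenSolI (fun t => sph lam₂ (hyp t)) (sphDecay lam₂))^[n] g s|
      ≤ c₂ ^ n * N * Real.exp (-ε * s) := by
  induction n with
  | zero => exact ⟨by simpa using hg, fun s hs => by simpa using hN s hs⟩
  | succ n ih =>
    obtain ⟨hcont, hb⟩ := ih
    have hN' : 0 ≤ c₂ ^ n * N := by positivity
    rw [Function.iterate_succ_apply']
    refine ⟨continuousOn_greenSolI hlam₂ hcont (abs_le_of_weighted hb) (by positivity) hε₂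
      (abs_le_exp_of_weighted hb), fun s hs => ?_⟩
    calc |greenSolI (fun t => sph lam₂ (hyp t)) (sphDecay lam₂)
          ((greenSolI (fun t => sph lam₂ (hyp t)) (sphDecay lam₂))^[n] g) s|
        ≤ c₂ * (c₂ ^ n * N) * Real.exp (-ε * s) := hbound _ _ hcont hN' hb s hs
      _ = c₂ ^ (n + 1) * N * Real.exp (-ε * s) := by ring

include hlam₂ hε₂ hg hN0 hN hc₂ hbound in
/-- **The terms of the Neumann expansion are dominated by a geometric series**:
`|(μ − μ₂)^k h_{k+1}(t)| ≤ c₂ N e^{−εt} (|μ − μ₂| c₂)^k`. -/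
theorem abs_neumann_term_le (k : ℕ) {t : ℝ} (ht : 0 < t) :
    |(lam * (lam - 2) - lam₂ * (lam₂ - 2)) ^ k
        * (greenSolI (fun t => sph lam₂ (hyp t)) (sphDecay lam₂))^[k + 1] g t|
      ≤ c₂ * N * Real.exp (-ε * t) * (|lam * (lam - 2) - lam₂ * (lam₂ - 2)| * c₂) ^ k := by
  have hb := (iterate_weighted hlam₂ hε₂ hg hN0 hN hc₂ hbound (k + 1)).2 t ht
  rw [abs_mul, abs_pow, mul_pow]
  calc |lam * (lam - 2) - lam₂ * (lam₂ - 2)| ^ k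
        * |(greenSolI (fun t => sph lam₂ (hyp t)) (sphDecay lam₂))^[k + 1] g t|
      ≤ |lam * (lam - 2) - lam₂ * (lam₂ - 2)| ^ k * (c₂ ^ (k + 1) * N * Real.exp (-ε * t)) :=
        mul_le_mul_of_nonneg_left hb (by positivity)
    _ = c₂ * N * Real.exp (-ε * t) * (|lam * (lam - 2) - lam₂ * (lam₂ - 2)| ^ k * c₂ ^ k) := by ring

include hlam₂ hε₂ hg hN0 hN hc₂ hbound in
/-- **The Neumann series is absolutely summable** for `|μ − μ₂| c₂ < 1`. -/
theorem summable_neumann_terms (hq : |lam * (lam - 2) - lam₂ * (lam₂ - 2)| * c₂ < 1) {t : ℝ} (ht : 0 < t) :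
    Summable (fun k : ℕ => (lam * (lam - 2) - lam₂ * (lam₂ - 2)) ^ k
      * (greenSolI (fun t => sph lam₂ (hyp t)) (sphDecay lam₂))^[k + 1] g t) := by
  have hq0 : 0 ≤ |lam * (lam - 2) - lam₂ * (lam₂ - 2)| * c₂ := by positivity
  refine Summable.of_norm_bounded
    (g := fun k : ℕ => c₂ * N * Real.exp (-ε * t) * (|lam * (lam - 2) - lam₂ * (lam₂ - 2)| * c₂) ^ k)
    ((summable_geometric_of_lt_one hq0 hq).mul_left _) (fun k => ?_)
  rw [Real.norm_eq_abs]
  exact abs_neumann_term_le hlam₂ hε₂ hg hN0 hN hc₂ hbound k ht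

include hlam hlam₂ hε₁ hε₂ hε₃ hg hN0 hN hc₂ hbound in
/-- **The remainder of the Neumann expansion tends to zero** for `|μ − μ₂| c₂ < 1`: with `c = c(λ, ε)` the
weighted bound of `G^I_λ`, `|(μ − μ₂)^{n+1} G^I_λ h_{n+1}(t)| ≤ c N e^{−εt} (|μ − μ₂| c₂)^{n+1}`. -/
theorem tendsto_neumann_remainder (hq : |lam * (lam - 2) - lam₂ * (lam₂ - 2)| * c₂ < 1) {t : ℝ} (ht : 0 < t) :
    Tendsto (fun n : ℕ => (lam * (lam - 2) - lam₂ * (lam₂ - 2)) ^ (n + 1)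
      * greenSolI (fun t => sph lam (hyp t)) (sphDecay lam)
        ((greenSolI (fun t => sph lam₂ (hyp t)) (sphDecay lam₂))^[n + 1] g) t) atTop (𝓝 0) := by
  obtain ⟨c, hc, hcb⟩ := exists_abs_greenSolI_le_weighted hlam hε₁ hε₃
  set q := |lam * (lam - 2) - lam₂ * (lam₂ - 2)| * c₂ with hq'
  have hq0 : 0 ≤ q := by positivity
  have hlim : Tendsto (fun n : ℕ => c * N * Real.exp (-ε * t) * q ^ (n + 1)) atTop (𝓝 0) := by
    have h := ((tendsto_pow_atTop_nhds_zero_of_lt_one hq0 hq).comp (tendsto_add_atTop_nat 1)).const_mul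
      (c * N * Real.exp (-ε * t))
    rw [mul_zero] at h
    exact h
  refine squeeze_zero_norm (fun n => ?_) hlim
  obtain ⟨hcont, hb⟩ := iterate_weighted hlam₂ hε₂ hg hN0 hN hc₂ hbound (n + 1)
  have hN' : 0 ≤ c₂ ^ (n + 1) * N := by positivity
  have hG := hcb _ _ hcont hN' hb t ht
  rw [Real.norm_eq_abs, abs_mul, abs_pow]
  calc |lam * (lam - 2) - lam₂ * (lam₂ - 2)| ^ (n + 1)
        * |greenSolI (fun t => sph lam (hyp t)) (sphDecay lam)
          ((greenSolI (fun t => sph lam₂ (hyp t)) (sphDecay lam₂))^[n + 1] g) t|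
      ≤ |lam * (lam - 2) - lam₂ * (lam₂ - 2)| ^ (n + 1) * (c * (c₂ ^ (n + 1) * N) * Real.exp (-ε * t)) :=
        mul_le_mul_of_nonneg_left hG (by positivity)
    _ = c * N * Real.exp (-ε * t) * q ^ (n + 1) := by rw [hq', mul_pow]; ring

include hlam hlam₂ hε₁ hε₂ hε₃ hg hN0 hN hc₂ hbound in
/-- **THE NEUMANN SERIES OF THE RESOLVENT CONVERGES TO THE RESOLVENT**: for `|μ − μ₂| c₂ < 1` and every `t > 0`,
`G^I_λ g(t) = Σ_{k=0}^{∞} (μ − μ₂)^k (G^I_{λ₂})^{k+1} g(t)`. -/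
theorem hasSum_neumann_series (hq : |lam * (lam - 2) - lam₂ * (lam₂ - 2)| * c₂ < 1) {t : ℝ} (ht : 0 < t) :
    HasSum (fun k : ℕ => (lam * (lam - 2) - lam₂ * (lam₂ - 2)) ^ k
        * (greenSolI (fun t => sph lam₂ (hyp t)) (sphDecay lam₂))^[k + 1] g t)
      (greenSolI (fun t => sph lam (hyp t)) (sphDecay lam) g t) := by
  set a : ℕ → ℝ := fun k => (lam * (lam - 2) - lam₂ * (lam₂ - 2)) ^ k
    * (greenSolI (fun t => sph lam₂ (hyp t)) (sphDecay lam₂))^[k + 1] g t with ha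
  have hsum : Summable a := summable_neumann_terms hlam₂ hε₂ hg hN0 hN hc₂ hbound hq ht
  -- the partial sums `∑_{k ≤ n} a k` converge to `tsum a` …
  have h1 : Tendsto (fun n : ℕ => ∑ k ∈ Finset.range (n + 1), a k) atTop (𝓝 (∑' k, a k)) :=
    hsum.hasSum.tendsto_sum_nat.comp (tendsto_add_atTop_nat 1)
  -- … and, by the finite expansion with remainder, to `G^I_λ g(t)`
  have h2 : Tendsto (fun n : ℕ => ∑ k ∈ Finset.range (n + 1), a k) atTop
      (𝓝 (greenSolI (fun t => sph lam (hyp t)) (sphDecay lam) g t)) := by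
    have hR := tendsto_neumann_remainder hlam hlam₂ hε₁ hε₂ hε₃ hg hN0 hN hc₂ hbound hq ht
    have hM := abs_le_of_weighted hN
    have hC := abs_le_exp_of_weighted hN
    have hfin : ∀ n : ℕ, ∑ k ∈ Finset.range (n + 1), a k
        = greenSolI (fun t => sph lam (hyp t)) (sphDecay lam) g t
          - (lam * (lam - 2) - lam₂ * (lam₂ - 2)) ^ (n + 1)
            * greenSolI (fun t => sph lam (hyp t)) (sphDecay lam)
              ((greenSolI (fun t => sph lam₂ (hyp t)) (sphDecay lam₂))^[n + 1] g) t := by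
      intro n
      have := neumann_finite hlam hlam₂ hg hM (by positivity) hε₁ hε₂ hC n ht
      rw [ha]
      linarith
    have h := (tendsto_const_nhds (x := greenSolI (fun t => sph lam (hyp t)) (sphDecay lam) g t)).sub hR
    rw [sub_zero] at h
    exact h.congr (fun n => (hfin n).symm)
  have heq : (∑' k, a k) = greenSolI (fun t => sph lam (hyp t)) (sphDecay lam) g t := tendsto_nhds_unique h1 h2
  rw [← heq]
  exact hsum.hasSum

include hlam hlam₂ hε₁ hε₂ hε₃ hg hN0 hN hc₂ hbound in
/-- The same in `tsum` form: `G^I_λ g(t) = ∑' k, (μ − μ₂)^k (G^I_{λ₂})^{k+1} g(t)`. -/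
theorem greenSolI_eq_tsum_neumann (hq : |lam * (lam - 2) - lam₂ * (lam₂ - 2)| * c₂ < 1) {t : ℝ} (ht : 0 < t) :
    greenSolI (fun t => sph lam (hyp t)) (sphDecay lam) g t
      = ∑' k : ℕ, (lam * (lam - 2) - lam₂ * (lam₂ - 2)) ^ k
          * (greenSolI (fun t => sph lam₂ (hyp t)) (sphDecay lam₂))^[k + 1] g t :=
  (hasSum_neumann_series hlam hlam₂ hε₁ hε₂ hε₃ hg hN0 hN hc₂ hbound hq ht).tsum_eq.symm

end measure

/-! ### The statement with the weighted bound supplied by row 506 -/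

section analytic

variable [MeasurableSpace Circle] [BorelSpace Circle]

/-- **THE RESOLVENT IS ANALYTIC IN THE SPECTRAL PARAMETER ON THE WEIGHTED SPACE**: for `λ₂ > 1` and
`2 − λ₂ < ε < λ₂` there is `c₂ ≥ 0` (the weighted bound of `G^I_{λ₂}`) such that for every `λ > 1` with
`2 − λ < ε < λ` and `|μ − μ₂| c₂ < 1`, and every source `|g| ≤ N e^{−εs}`,
`G^I_λ g(t) = Σ_{k=0}^{∞} (μ − μ₂)^k (G^I_{λ₂})^{k+1} g(t)` for all `t > 0`. -/
theorem exists_neumann_radius {lam₂ ε : ℝ} (hlam₂ : 1 < lam₂) (hε₂ : 2 - lam₂ < ε) (hε₄ : ε < lam₂) :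
    ∃ c₂ : ℝ, 0 ≤ c₂ ∧ ∀ (lam : ℝ), 1 < lam → 2 - lam < ε → ε < lam →
      |lam * (lam - 2) - lam₂ * (lam₂ - 2)| * c₂ < 1 →
      ∀ (g : ℝ → ℝ) (N : ℝ), ContinuousOn g (Ioi 0) → 0 ≤ N → (∀ s, 0 < s → |g s| ≤ N * Real.exp (-ε * s)) →
      ∀ t, 0 < t → HasSum (fun k : ℕ => (lam * (lam - 2) - lam₂ * (lam₂ - 2)) ^ k
          * (greenSolI (fun t => sph lam₂ (hyp t)) (sphDecay lam₂))^[k + 1] g t)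
        (greenSolI (fun t => sph lam (hyp t)) (sphDecay lam) g t) := by
  obtain ⟨c₂, hc₂, hbound⟩ := exists_abs_greenSolI_le_weighted hlam₂ hε₂ hε₄
  exact ⟨c₂, hc₂, fun lam hlam hε₁ hε₃ hq g N hg hN0 hN t ht =>
    hasSum_neumann_series hlam hlam₂ hε₁ hε₂ hε₃ hg hN0 hN hc₂ hbound hq ht⟩

end analytic

end Summit.Ventures.HodgeRepro2.T5SU11ResolventNeumannSeries
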